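import Summits.QuantumFields.YangMills.Theorems.UnitScaleTiltProp7FibreLevelMassInduction
import HarnessLib

/-!
# Route `UnitScaleTilt`, crux K1 «MinimiserStabilityRegPr» (stmt-QuantumFields-19200), route-R E′ S3 (P), row `hq` (the DEFECT row), file A1 (pure reals) —
# THE SHARP TOP-LEVEL SOURCE SUM AND THE SHARP END-GAME: the factor `θ` (the two-block sups of the level ratios) is KEPT on the gauge datum,
# `ρᵏ·(e_kS_k + D·Σ_{j<k}C·e_jS_j) ≤ θ·E·K₀·(E·x₀·ρ^{2k+1}∕(1−ρ²) + (ρ³∕(1−ρ⁴))·Γ)` and `Lᵏ·W♯² ≤ 2·10⁶L²θ²·LᵏB + 10⁶L⁴θ²(Lᵏ)⁻¹x₀²`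

Cell `ym3-torus`, D-0154 (3c) twin-width seat `ym-routeR-w2` (gen 6); ★p1 g16 NAMER WORD 6 (ii) «hq DEFECT ROW» (2026-08-28 23:39Z), w4-19200 g7 first-refusal pass
(23:43Z), WORD 10 RULING «three-slot hq; FILES A∕B GO» (23:55Z); LOCATE `ym-routeR-w2/LOCATE-HQ-DEFECT-routeRw2g6.md` (19200 evidence).  THEOREMS ONLY (0 `def`, 0 `sorry`);
`--supports stmt-QuantumFields-19200`, count-neutral.  YM₃ on T³ is a ladder rung (R3), not the Clay problem; nothing here claims the stub, the crux, E′, d = 4 or the mass gap.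

THE POINT.  The landed scalar induction ✓ `Prop7FibreLevelMassInduction.levelMass_induction` closes the triangular system of the level masses `x_i` of the ratio tower
(sources `S_j = Σ_{l<j}ρ^{j−1−l}·260μ_lC₁·x_l` with `260μ_lC₁ ≤ θρ^{2(k−l)}`, gauge data `ρⁱλ_i ≤ B`) as (1) `ρⁱx_i ≤ Eρ^{2i}x₀ + Γ`, `Γ = 2(DB + θEK₀·Ex₀ρ^{2k+1}∕(1−ρ²))`, and
(2) `ρᵏ(e_kS_k + DΣ_{j<k}Ce_jS_j) ≤ DB + 2θEK₀(…)`.  Its own `key`∕`core` estimates give (2) with an OVERALL factor `θ` — `≤ θEK₀·(Ex₀ρ^{2k+1}∕(1−ρ²) + (ρ³∕(1−ρ⁴))Γ)` — and the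
landed statement then spends the absorption `θEK₀ρ³∕(1−ρ⁴) ≤ ½` to write `½Γ`.  For the level MASSES that is immaterial (`DB` is zeroth order there); for the (P) knit's defect
row `hq` (the true linearised average of the chart of an EXACT fibre point, second order in the sup chart) it is the content.  §1 re-derives the sharp (2) from (1) as a pure-real
lemma (`Γ` abstract; no landed proof touched); §2 is the numeric end-game with `θ²` kept on the gauge term (`K₀ ≤ 132L²`, `ρ³∕(1−ρ⁴) ≤ (7∕10)L⁻¹`, `ρ²L = 1`, `D² = 12`,
`θ(3∕2)K₀·q ≤ ½` used once, on the `x₀`-part only).  Consumer: file A2 ✓∕⧗ `…Prop7TrueLinIterSharpFibreT3` (the T³ statement), then file B `…Prop7LinAvgDefectOfExactFibrePoint`.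

WHAT IS PROVED (ns `…Theorems.Prop7TrueLinIterSharpLetters`): `sourceSum_le_of_levelMasses`, `endgame_sharp`.
HONEST SCOPE.  Real arithmetic only; nothing of [Balaban1985Averaging] is asserted; the numerals are the tree's, compounded, with no attempt at sharpness.

References: T. Bałaban, CMP 98 (1985) 17–51 [Balaban1985Averaging] (Prop. 3 (122)–(126) p.36); CMP 95 (1984) 17–40 [Balaban1984PropagatorsI] ((1.18)–(1.20) pp.19–20);
CMP 102 (1985) 277–309 [Balaban1985Variational] ((14)–(15) p.280, Prop. 7 p.299).
-/

set_option autoImplicit false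

noncomputable section

open scoped BigOperators

namespace Summit.QuantumFields.YangMills.Theorems.Prop7TrueLinIterSharpLetters

open Summit.QuantumFields.YangMills.Theorems.Prop7FibreLevelMassInduction (geom_sum_reflect_le)

/-! ## §1 The sharp top-level source sum (pure reals) -/

/-- **THE SHARP SOURCE SUM.**  Reals `0 < ρ < 1`, `θ, E, C, D, C₁, x₀, Γ ≥ 0`; sequences `x ≥ 0` (the level masses), `e` (`0 ≤ e j ≤ E`), `μ` (`0 ≤ μ l`,
`260·μ_l·C₁ ≤ θ·ρ^{2(k−l)}`, the two-block sups), `S j = Σ_{l<j}ρ^{j−1−l}·260·μ_l·C₁·x_l` (the sources); INPUT: the level-mass bound `ρˡx_l ≤ Eρ^{2l}x₀ + Γ` for `l < k`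
(conclusion (1) of ✓ `levelMass_induction`, `Γ` abstract).  THEN, with `K₀ = 1 + D·C·ρ∕(1−ρ)` and NO absorption spent,
`ρᵏ·(e_kS_k + D·Σ_{j<k}C·e_jS_j) ≤ θ·E·K₀·(E·x₀·ρ^{2k+1}∕(1−ρ²)) + θ·E·K₀·(ρ³∕(1−ρ⁴))·Γ` — an overall factor `θ`. (The `key`∕`core` estimates of ✓ `levelMass_induction`.) [folklore] -/
theorem sourceSum_le_of_levelMasses {ρ θ E C D C₁ x₀ Γ : ℝ} (hρ0 : 0 < ρ) (hρ1 : ρ < 1) (hθ : 0 ≤ θ) (hE : 0 ≤ E) (hC : 0 ≤ C) (hD : 0 ≤ D)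
    (hC₁ : 0 ≤ C₁) (hx₀ : 0 ≤ x₀) (hΓ0 : 0 ≤ Γ) (k : ℕ) (x e μ S : ℕ → ℝ)
    (hx : ∀ i, 0 ≤ x i)
    (he : ∀ j ≤ k, 0 ≤ e j ∧ e j ≤ E)
    (hμ : ∀ l < k, 0 ≤ μ l ∧ 260 * (μ l * C₁) ≤ θ * ρ ^ (2 * (k - l)))
    (hS : ∀ j, S j = ∑ l ∈ Finset.range j, ρ ^ (j - 1 - l) * (260 * (μ l * (C₁ * x l))))
    (hmain : ∀ l < k, ρ ^ l * x l ≤ E * ρ ^ (2 * l) * x₀ + Γ) :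
    ρ ^ k * (e k * S k + D * ∑ j ∈ Finset.range k, C * (e j * S j))
      ≤ θ * E * (1 + D * C * (ρ / (1 - ρ))) * (E * x₀ * ρ ^ (2 * k + 1) / (1 - ρ ^ 2))
        + θ * E * (1 + D * C * (ρ / (1 - ρ))) * (ρ ^ 3 / (1 - ρ ^ 4)) * Γ := by
  -- letters (plain `have`-abbreviations through equalities, no `set`)
  have hρle1 : ρ ≤ 1 := hρ1.le
  have h1ρ : 0 < 1 - ρ := by linarith
  have hρ2lt : ρ ^ 2 < 1 := by nlinarith
  have hρ4lt : ρ ^ 4 < 1 := by nlinarith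
  have h1ρ2 : 0 < 1 - ρ ^ 2 := by linarith
  have h1ρ4 : 0 < 1 - ρ ^ 4 := by linarith
  have hK₀ : 1 ≤ 1 + D * C * (ρ / (1 - ρ)) := by
    have : 0 ≤ D * C * (ρ / (1 - ρ)) := by positivity
    linarith
  have hK₀0 : 0 ≤ 1 + D * C * (ρ / (1 - ρ)) := by linarith
  have hq0 : 0 ≤ ρ ^ 3 / (1 - ρ ^ 4) := by positivity
  have hP0 : 0 ≤ E * x₀ * ρ ^ (2 * k + 1) / (1 - ρ ^ 2) := by positivity
  -- the sources are nonnegative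
  have hS0 : ∀ j ≤ k, 0 ≤ S j := by
    intro j hj
    rw [hS j]
    refine Finset.sum_nonneg fun l hl => ?_
    have hlk : l < k := lt_of_lt_of_le (Finset.mem_range.mp hl) hj
    have := (hμ l hlk).1
    have := hx l
    positivity
  -- ★ the key estimate: an old-mass bound at all levels `l < j` controls `ρʲ·S_j`
  have key : ∀ j ≤ k, (∀ l < j, ρ ^ l * x l ≤ E * ρ ^ (2 * l) * x₀ + Γ) →
      ρ ^ j * S j ≤ θ * (E * x₀ * ρ ^ (2 * k + 1) / (1 - ρ ^ 2)
        + Γ * (ρ ^ 3 / (1 - ρ ^ 4))) := by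
    intro j hj IH
    rw [hS j, Finset.mul_sum]
    have hterm : ∀ l ∈ Finset.range j, ρ ^ j * (ρ ^ (j - 1 - l) * (260 * (μ l * (C₁ * x l))))
        ≤ θ * E * x₀ * ρ ^ (2 * k + 1) * (ρ ^ 2) ^ (j - 1 - l)
          + θ * (Γ) * ρ ^ 3 * (ρ ^ 4) ^ (j - 1 - l) := by
      intro l hl
      have hlj : l < j := Finset.mem_range.mp hl
      have hlk : l < k := lt_of_lt_of_le hlj hj
      obtain ⟨hμ0, hμθ⟩ := hμ l hlk
      have hIH := IH l hlj
      have hxl := hx l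
      have e1 : ρ ^ j * ρ ^ (j - 1 - l) = ρ ^ (2 * (j - 1 - l) + 1) * ρ ^ l := by
        rw [← pow_add, ← pow_add]; congr 1; omega
      have hp0 : 0 ≤ ρ ^ (2 * (j - 1 - l) + 1) := pow_nonneg hρ0.le _
      have hμC0 : 0 ≤ 260 * (μ l * C₁) := by positivity
      have hρlx : 0 ≤ ρ ^ l * x l := mul_nonneg (pow_nonneg hρ0.le _) hxl
      have hρ3 : ρ ^ (2 * (k - j) + 3) ≤ ρ ^ 3 := pow_le_pow_of_le_one hρ0.le hρle1 (by omega)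
      calc ρ ^ j * (ρ ^ (j - 1 - l) * (260 * (μ l * (C₁ * x l))))
          = (ρ ^ j * ρ ^ (j - 1 - l)) * (260 * (μ l * C₁)) * x l := by ring
        _ = ρ ^ (2 * (j - 1 - l) + 1) * (260 * (μ l * C₁)) * (ρ ^ l * x l) := by rw [e1]; ring
        _ ≤ ρ ^ (2 * (j - 1 - l) + 1) * (θ * ρ ^ (2 * (k - l)))
              * (E * ρ ^ (2 * l) * x₀ + Γ) :=
            mul_le_mul (mul_le_mul_of_nonneg_left hμθ hp0) hIH hρlx (mul_nonneg hp0 (mul_nonneg hθ (pow_nonneg hρ0.le _)))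
        _ = θ * E * x₀ * (ρ ^ (2 * (j - 1 - l) + 1) * ρ ^ (2 * (k - l)) * ρ ^ (2 * l))
              + θ * (Γ)
                * (ρ ^ (2 * (j - 1 - l) + 1) * ρ ^ (2 * (k - l))) := by ring
        _ = θ * E * x₀ * (ρ ^ (2 * k + 1) * (ρ ^ 2) ^ (j - 1 - l))
              + θ * (Γ)
                * (ρ ^ (2 * (k - j) + 3) * (ρ ^ 4) ^ (j - 1 - l)) := by
            congr 2
            · rw [← pow_mul, ← pow_add, ← pow_add, ← pow_add]; congr 1; omega
            · rw [← pow_mul, ← pow_add, ← pow_add]; congr 1; omega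
        _ ≤ θ * E * x₀ * (ρ ^ (2 * k + 1) * (ρ ^ 2) ^ (j - 1 - l))
              + θ * (Γ)
                * (ρ ^ 3 * (ρ ^ 4) ^ (j - 1 - l)) := by
            have h4 : 0 ≤ (ρ ^ 4) ^ (j - 1 - l) := pow_nonneg (pow_nonneg hρ0.le 4) _
            have := mul_le_mul_of_nonneg_left (mul_le_mul_of_nonneg_right hρ3 h4) (mul_nonneg hθ hΓ0)
            linarith
        _ = _ := by ring
    calc ∑ l ∈ Finset.range j, ρ ^ j * (ρ ^ (j - 1 - l) * (260 * (μ l * (C₁ * x l))))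
        ≤ ∑ l ∈ Finset.range j, (θ * E * x₀ * ρ ^ (2 * k + 1) * (ρ ^ 2) ^ (j - 1 - l)
          + θ * (Γ) * ρ ^ 3 * (ρ ^ 4) ^ (j - 1 - l)) :=
          Finset.sum_le_sum hterm
      _ = θ * E * x₀ * ρ ^ (2 * k + 1) * ∑ l ∈ Finset.range j, (ρ ^ 2) ^ (j - 1 - l)
          + θ * (Γ) * ρ ^ 3
            * ∑ l ∈ Finset.range j, (ρ ^ 4) ^ (j - 1 - l) := by
          rw [Finset.sum_add_distrib, ← Finset.mul_sum, ← Finset.mul_sum]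
      _ ≤ θ * E * x₀ * ρ ^ (2 * k + 1) * (1 / (1 - ρ ^ 2))
          + θ * (Γ) * ρ ^ 3
            * (1 / (1 - ρ ^ 4)) :=
          add_le_add (mul_le_mul_of_nonneg_left (geom_sum_reflect_le (pow_nonneg hρ0.le 2) hρ2lt j) (by positivity))
            (mul_le_mul_of_nonneg_left (geom_sum_reflect_le (pow_nonneg hρ0.le 4) hρ4lt j) (by positivity))
      _ = _ := by ring
  -- ★ the level row after multiplication by `ρⁱ`: the source and gauge-sum parts
  have core : ∀ i ≤ k, (∀ l < i, ρ ^ l * x l ≤ E * ρ ^ (2 * l) * x₀ + Γ) →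
      e i * (ρ ^ i * S i) + D * (ρ ^ i * ∑ j ∈ Finset.range i, C * (e j * S j))
        ≤ θ * E * (1 + D * C * (ρ / (1 - ρ))) * (E * x₀ * ρ ^ (2 * k + 1) / (1 - ρ ^ 2))
          + θ * E * (1 + D * C * (ρ / (1 - ρ))) * (ρ ^ 3 / (1 - ρ ^ 4))
            * (Γ) := by
    intro i hi IH
    -- `ρʲS_j` for every `j ≤ i`
    have hSj : ∀ j ≤ i, ρ ^ j * S j ≤ θ * (E * x₀ * ρ ^ (2 * k + 1) / (1 - ρ ^ 2)
        + Γ * (ρ ^ 3 / (1 - ρ ^ 4))) :=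
      fun j hj => key j (hj.trans hi) (fun l hl => IH l (lt_of_lt_of_le hl hj))
    have hT0 : 0 ≤ θ * (E * x₀ * ρ ^ (2 * k + 1) / (1 - ρ ^ 2)
        + Γ * (ρ ^ 3 / (1 - ρ ^ 4))) := by positivity
    obtain ⟨hei0, heiE⟩ := he i hi
    -- the source part
    have hc : e i * (ρ ^ i * S i) ≤ E * (θ * (E * x₀ * ρ ^ (2 * k + 1) / (1 - ρ ^ 2)
        + Γ * (ρ ^ 3 / (1 - ρ ^ 4)))) :=
      mul_le_mul heiE (hSj i le_rfl) (mul_nonneg (pow_nonneg hρ0.le _) (hS0 i hi)) hE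
    -- the gauge double sum
    have hd : ρ ^ i * ∑ j ∈ Finset.range i, C * (e j * S j) ≤ C * E * (θ * (E * x₀ * ρ ^ (2 * k + 1) / (1 - ρ ^ 2)
        + Γ * (ρ ^ 3 / (1 - ρ ^ 4)))) * (ρ / (1 - ρ)) := by
      rw [Finset.mul_sum]
      have hterm : ∀ j ∈ Finset.range i, ρ ^ i * (C * (e j * S j)) ≤ C * E * (θ * (E * x₀ * ρ ^ (2 * k + 1) / (1 - ρ ^ 2)
          + Γ * (ρ ^ 3 / (1 - ρ ^ 4)))) * (ρ ^ (i - 1 - j) * ρ) := by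
        intro j hj
        have hji : j < i := Finset.mem_range.mp hj
        have epow : ρ ^ i = ρ ^ (i - 1 - j) * ρ * ρ ^ j := by
          rw [← pow_succ, ← pow_add]; congr 1; omega
        obtain ⟨hej0, hejE⟩ := he j (le_trans hji.le hi)
        have hSj' := hSj j hji.le
        have hS0' : 0 ≤ ρ ^ j * S j := mul_nonneg (pow_nonneg hρ0.le _) (hS0 j (le_trans hji.le hi))
        rw [epow]
        calc ρ ^ (i - 1 - j) * ρ * ρ ^ j * (C * (e j * S j)) = C * e j * (ρ ^ j * S j) * (ρ ^ (i - 1 - j) * ρ) := by ring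
          _ ≤ C * E * (θ * (E * x₀ * ρ ^ (2 * k + 1) / (1 - ρ ^ 2)
              + Γ * (ρ ^ 3 / (1 - ρ ^ 4)))) * (ρ ^ (i - 1 - j) * ρ) := by
              refine mul_le_mul_of_nonneg_right ?_ (mul_nonneg (pow_nonneg hρ0.le _) hρ0.le)
              exact mul_le_mul (mul_le_mul_of_nonneg_left hejE hC) hSj' hS0' (by positivity)
      calc ∑ j ∈ Finset.range i, ρ ^ i * (C * (e j * S j))
          ≤ ∑ j ∈ Finset.range i, C * E * (θ * (E * x₀ * ρ ^ (2 * k + 1) / (1 - ρ ^ 2)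
              + Γ * (ρ ^ 3 / (1 - ρ ^ 4)))) * (ρ ^ (i - 1 - j) * ρ) :=
            Finset.sum_le_sum hterm
        _ = C * E * (θ * (E * x₀ * ρ ^ (2 * k + 1) / (1 - ρ ^ 2)
              + Γ * (ρ ^ 3 / (1 - ρ ^ 4))))
              * ((∑ j ∈ Finset.range i, ρ ^ (i - 1 - j)) * ρ) := by
            rw [← Finset.mul_sum, Finset.sum_mul]
        _ ≤ C * E * (θ * (E * x₀ * ρ ^ (2 * k + 1) / (1 - ρ ^ 2)
              + Γ * (ρ ^ 3 / (1 - ρ ^ 4)))) * ((1 / (1 - ρ)) * ρ) :=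
            mul_le_mul_of_nonneg_left (mul_le_mul_of_nonneg_right (geom_sum_reflect_le hρ0.le hρ1 i) hρ0.le) (by positivity)
        _ = _ := by ring
    have hdd := mul_le_mul_of_nonneg_left hd hD
    have e1 : E * (θ * (E * x₀ * ρ ^ (2 * k + 1) / (1 - ρ ^ 2)
        + Γ * (ρ ^ 3 / (1 - ρ ^ 4))))
        + D * (C * E * (θ * (E * x₀ * ρ ^ (2 * k + 1) / (1 - ρ ^ 2)
        + Γ * (ρ ^ 3 / (1 - ρ ^ 4)))) * (ρ / (1 - ρ)))
        = θ * E * (1 + D * C * (ρ / (1 - ρ))) * (E * x₀ * ρ ^ (2 * k + 1) / (1 - ρ ^ 2))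
          + θ * E * (1 + D * C * (ρ / (1 - ρ))) * (ρ ^ 3 / (1 - ρ ^ 4))
            * (Γ) := by ring
    linarith [hc, hdd, e1]
  -- ★ the top level
  have hcore := core k le_rfl hmain
  have expand : ρ ^ k * (e k * S k + D * ∑ j ∈ Finset.range k, C * (e j * S j))
      = e k * (ρ ^ k * S k) + D * (ρ ^ k * ∑ j ∈ Finset.range k, C * (e j * S j)) := by ring
  rw [expand]
  linarith [hcore]

/-! ## §2 The numeric end-game with `θ²` kept on the gauge term -/

set_option maxHeartbeats 400000 in
/-- **THE SHARP END-GAME** (pure reals): with `ρ²L = 1`, `0 < ρ < 1`, `D² = 12`, `0 ≤ D`, `0 ≤ K₀ ≤ 132L²`, `L ≥ 3`, `0 ≤ q ≤ (7∕10)L⁻¹`, `θ·(3∕2)·K₀·q ≤ ½`, `θ, x₀, B ≥ 0`, and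
`P := (3∕2)·x₀·ρ^{2k+1}∕(1−ρ²)`:  `Lᵏ·(θ(3∕2)K₀·P + θ(3∕2)K₀·q·2(D√B + θ(3∕2)K₀·P))² ≤ 2·10⁶·L²·θ²·(Lᵏ·B) + 10⁶·L⁴·θ²·(Lᵏ)⁻¹·x₀²`. [folklore] -/
theorem endgame_sharp {L ρ D K₀ B q : ℝ} (θ x₀ : ℝ) (k : ℕ) (hL : 3 ≤ L) (hρL : ρ ^ 2 * L = 1) (hρ0 : 0 < ρ) (hρ1 : ρ < 1) (hD : D ^ 2 = 12)
    (hD0 : 0 ≤ D) (hK0 : 0 ≤ K₀) (hK : K₀ ≤ 132 * L ^ 2) (hB : 0 ≤ B) (hθ : 0 ≤ θ) (hx₀ : 0 ≤ x₀) (hq0 : 0 ≤ q) (hq : q ≤ 7 / 10 * L⁻¹)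
    (hsmall : θ * (3 / 2) * K₀ * q ≤ 1 / 2) :
    L ^ k * (θ * (3 / 2) * K₀ * ((3 / 2) * x₀ * ρ ^ (2 * k + 1) / (1 - ρ ^ 2))
        + θ * (3 / 2) * K₀ * q * (2 * (D * Real.sqrt B + θ * (3 / 2) * K₀ * ((3 / 2) * x₀ * ρ ^ (2 * k + 1) / (1 - ρ ^ 2))))) ^ 2
      ≤ 2000000 * L ^ 2 * θ ^ 2 * (L ^ k * B) + 1000000 * L ^ 4 * θ ^ 2 * (L ^ k)⁻¹ * x₀ ^ 2 := by
  have hL0 : 0 < L := by linarith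
  have hV : 0 < L ^ k := pow_pos hL0 k
  have hLne : L ≠ 0 := hL0.ne'
  have hρ2lt : ρ ^ 2 < 1 := pow_lt_one₀ hρ0.le hρ1 (by norm_num)
  have h1ρ2 : 0 < 1 - ρ ^ 2 := by linarith
  have hρ2 : ρ ^ 2 = L⁻¹ := eq_inv_of_mul_eq_one_left hρL
  have hs : 1 - ρ ^ 2 = (L - 1) / L := by rw [hρ2]; field_simp
  -- scalar numerals first (small context)
  have hfrac : L / (L - 1) ^ 2 ≤ 3 / 4 := by
    have hpos : (0 : ℝ) < (L - 1) ^ 2 := by nlinarith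
    rw [div_le_iff₀ hpos]
    nlinarith [mul_nonneg (sub_nonneg.2 hL) (by linarith : (0 : ℝ) ≤ 3 * L - 1)]
  have hfrac0 : 0 ≤ L / (L - 1) ^ 2 := by
    have : (0 : ℝ) ≤ (L - 1) ^ 2 := sq_nonneg _
    positivity
  have hK2 : K₀ ^ 2 ≤ 17424 * L ^ 4 := by nlinarith [mul_le_mul hK hK hK0 (by positivity), hK0]
  have hq2 : q ^ 2 ≤ 49 / 100 * (L⁻¹) ^ 2 := by
    calc q ^ 2 ≤ (7 / 10 * L⁻¹) ^ 2 := pow_le_pow_left₀ hq0 hq 2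
      _ = 49 / 100 * (L⁻¹) ^ 2 := by ring
  have hLinv : (L⁻¹) ^ 2 * L ^ 2 = 1 := by field_simp
  -- the one k-dependent identity: `Lᵏ·(ρ^{2k+1})²·(Lᵏ·L) = (ρ²L)^{2k+1} = 1`
  have hid : L ^ k * (ρ ^ (2 * k + 1)) ^ 2 * (L ^ k * L) = 1 := by
    have : L ^ k * (ρ ^ (2 * k + 1)) ^ 2 * (L ^ k * L) = (ρ ^ 2 * L) ^ (2 * k + 1) := by ring
    rw [this, hρL, one_pow]
  have hu : L ^ k * (ρ ^ (2 * k + 1)) ^ 2 = (L ^ k)⁻¹ * L⁻¹ := by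
    rw [← mul_inv]
    exact eq_inv_of_mul_eq_one_left hid
  -- letters `A := θ(3/2)K₀ ≥ 0`, `P ≥ 0`
  have hA0 : 0 ≤ θ * (3 / 2) * K₀ := by positivity
  have hP0 : 0 ≤ (3 / 2) * x₀ * ρ ^ (2 * k + 1) / (1 - ρ ^ 2) := by positivity
  have hsB0 : 0 ≤ Real.sqrt B := Real.sqrt_nonneg _
  have hDB0 : 0 ≤ D * Real.sqrt B := mul_nonneg hD0 hsB0
  have hAP0 : 0 ≤ θ * (3 / 2) * K₀ * ((3 / 2) * x₀ * ρ ^ (2 * k + 1) / (1 - ρ ^ 2)) := mul_nonneg hA0 hP0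
  have hAqDB0 : 0 ≤ θ * (3 / 2) * K₀ * q * (D * Real.sqrt B) := by positivity
  -- `W ≤ 2A·P + 2A·q·D√B` (the absorption `2Aq ≤ 1` used once, on the `P`-part only) and `0 ≤ W`
  have hW0 : 0 ≤ θ * (3 / 2) * K₀ * ((3 / 2) * x₀ * ρ ^ (2 * k + 1) / (1 - ρ ^ 2))
        + θ * (3 / 2) * K₀ * q * (2 * (D * Real.sqrt B + θ * (3 / 2) * K₀ * ((3 / 2) * x₀ * ρ ^ (2 * k + 1) / (1 - ρ ^ 2)))) := by positivity
  have hWle : θ * (3 / 2) * K₀ * ((3 / 2) * x₀ * ρ ^ (2 * k + 1) / (1 - ρ ^ 2))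
        + θ * (3 / 2) * K₀ * q * (2 * (D * Real.sqrt B + θ * (3 / 2) * K₀ * ((3 / 2) * x₀ * ρ ^ (2 * k + 1) / (1 - ρ ^ 2))))
      ≤ 2 * (θ * (3 / 2) * K₀ * ((3 / 2) * x₀ * ρ ^ (2 * k + 1) / (1 - ρ ^ 2))) + 2 * (θ * (3 / 2) * K₀ * q * (D * Real.sqrt B)) := by
    have h1 : θ * (3 / 2) * K₀ * q * (2 * (θ * (3 / 2) * K₀ * ((3 / 2) * x₀ * ρ ^ (2 * k + 1) / (1 - ρ ^ 2))))
        ≤ 1 / 2 * (2 * (θ * (3 / 2) * K₀ * ((3 / 2) * x₀ * ρ ^ (2 * k + 1) / (1 - ρ ^ 2)))) :=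
      mul_le_mul_of_nonneg_right hsmall (by positivity)
    have e : θ * (3 / 2) * K₀ * ((3 / 2) * x₀ * ρ ^ (2 * k + 1) / (1 - ρ ^ 2))
        + θ * (3 / 2) * K₀ * q * (2 * (D * Real.sqrt B + θ * (3 / 2) * K₀ * ((3 / 2) * x₀ * ρ ^ (2 * k + 1) / (1 - ρ ^ 2))))
        = θ * (3 / 2) * K₀ * ((3 / 2) * x₀ * ρ ^ (2 * k + 1) / (1 - ρ ^ 2)) + 2 * (θ * (3 / 2) * K₀ * q * (D * Real.sqrt B))
          + θ * (3 / 2) * K₀ * q * (2 * (θ * (3 / 2) * K₀ * ((3 / 2) * x₀ * ρ ^ (2 * k + 1) / (1 - ρ ^ 2)))) := by ring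
    rw [e]
    linarith [h1]
  -- squares: `W² ≤ 8(A·P)² + 8(A·q·D√B)²`, `(√B)² = B`
  have hsq : (θ * (3 / 2) * K₀ * ((3 / 2) * x₀ * ρ ^ (2 * k + 1) / (1 - ρ ^ 2))
        + θ * (3 / 2) * K₀ * q * (2 * (D * Real.sqrt B + θ * (3 / 2) * K₀ * ((3 / 2) * x₀ * ρ ^ (2 * k + 1) / (1 - ρ ^ 2))))) ^ 2
      ≤ 8 * (θ * (3 / 2) * K₀ * ((3 / 2) * x₀ * ρ ^ (2 * k + 1) / (1 - ρ ^ 2))) ^ 2 + 8 * ((θ * (3 / 2) * K₀) ^ 2 * q ^ 2 * (D ^ 2 * B)) := by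
    have h1 := pow_le_pow_left₀ hW0 hWle 2
    have e : (2 * (θ * (3 / 2) * K₀ * ((3 / 2) * x₀ * ρ ^ (2 * k + 1) / (1 - ρ ^ 2))) + 2 * (θ * (3 / 2) * K₀ * q * (D * Real.sqrt B))) ^ 2
        = 8 * (θ * (3 / 2) * K₀ * ((3 / 2) * x₀ * ρ ^ (2 * k + 1) / (1 - ρ ^ 2))) ^ 2 + 8 * ((θ * (3 / 2) * K₀) ^ 2 * q ^ 2 * (D ^ 2 * (Real.sqrt B) ^ 2))
          - 4 * (θ * (3 / 2) * K₀ * ((3 / 2) * x₀ * ρ ^ (2 * k + 1) / (1 - ρ ^ 2)) - θ * (3 / 2) * K₀ * q * (D * Real.sqrt B)) ^ 2 := by ring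
    rw [e, Real.sq_sqrt hB] at h1
    have h4 : 0 ≤ 4 * (θ * (3 / 2) * K₀ * ((3 / 2) * x₀ * ρ ^ (2 * k + 1) / (1 - ρ ^ 2)) - θ * (3 / 2) * K₀ * q * (D * Real.sqrt B)) ^ 2 := by positivity
    linarith [h1, h4]
  -- the `P`-part in closed form: `Lᵏ·(A·P)² = (9/4)A²·x₀²·(L/(L−1)²)·(Lᵏ)⁻¹`
  have hT2 : L ^ k * (θ * (3 / 2) * K₀ * ((3 / 2) * x₀ * ρ ^ (2 * k + 1) / (1 - ρ ^ 2))) ^ 2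
      = 9 / 4 * (θ * (3 / 2) * K₀) ^ 2 * x₀ ^ 2 * (L / (L - 1) ^ 2) * (L ^ k)⁻¹ := by
    calc L ^ k * (θ * (3 / 2) * K₀ * ((3 / 2) * x₀ * ρ ^ (2 * k + 1) / (1 - ρ ^ 2))) ^ 2
        = 9 / 4 * (θ * (3 / 2) * K₀) ^ 2 * x₀ ^ 2 * (L ^ k * (ρ ^ (2 * k + 1)) ^ 2) * (1 / (1 - ρ ^ 2)) ^ 2 := by ring
      _ = 9 / 4 * (θ * (3 / 2) * K₀) ^ 2 * x₀ ^ 2 * ((L ^ k)⁻¹ * L⁻¹) * (1 / ((L - 1) / L)) ^ 2 := by rw [hu, hs]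
      _ = 9 / 4 * (θ * (3 / 2) * K₀) ^ 2 * x₀ ^ 2 * (L / (L - 1) ^ 2) * (L ^ k)⁻¹ := by
          have hL1ne : L - 1 ≠ 0 := by
            have : 0 < L - 1 := by linarith
            exact this.ne'
          field_simp
  -- the `P`-part: `Lᵏ·8(A·P)² ≤ 529254·L⁴·θ²x₀²(Lᵏ)⁻¹`
  have hx2 : 0 ≤ θ ^ 2 * x₀ ^ 2 * (L ^ k)⁻¹ := by positivity
  have hPpart : L ^ k * (8 * (θ * (3 / 2) * K₀ * ((3 / 2) * x₀ * ρ ^ (2 * k + 1) / (1 - ρ ^ 2))) ^ 2)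
      ≤ 529254 * (L ^ 4 * (θ ^ 2 * x₀ ^ 2 * (L ^ k)⁻¹)) := by
    have e : L ^ k * (8 * (θ * (3 / 2) * K₀ * ((3 / 2) * x₀ * ρ ^ (2 * k + 1) / (1 - ρ ^ 2))) ^ 2)
        = 81 / 2 * (K₀ ^ 2 * (L / (L - 1) ^ 2)) * (θ ^ 2 * x₀ ^ 2 * (L ^ k)⁻¹) := by
      have : L ^ k * (8 * (θ * (3 / 2) * K₀ * ((3 / 2) * x₀ * ρ ^ (2 * k + 1) / (1 - ρ ^ 2))) ^ 2)
          = 8 * (L ^ k * (θ * (3 / 2) * K₀ * ((3 / 2) * x₀ * ρ ^ (2 * k + 1) / (1 - ρ ^ 2))) ^ 2) := by ring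
      rw [this, hT2]; ring
    rw [e]
    have hprod : K₀ ^ 2 * (L / (L - 1) ^ 2) ≤ 17424 * L ^ 4 * (3 / 4) := mul_le_mul hK2 hfrac hfrac0 (by positivity)
    have h3 := mul_le_mul_of_nonneg_right hprod hx2
    linarith [h3]
  -- the gauge part: `Lᵏ·8A²q²D²B ≤ 1845000·L²·θ²·LᵏB`
  have hLB0 : 0 ≤ θ ^ 2 * (L ^ k * B) := by positivity
  have hBpart : L ^ k * (8 * ((θ * (3 / 2) * K₀) ^ 2 * q ^ 2 * (D ^ 2 * B))) ≤ 1845000 * (L ^ 2 * (θ ^ 2 * (L ^ k * B))) := by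
    rw [hD]
    have e : L ^ k * (8 * ((θ * (3 / 2) * K₀) ^ 2 * q ^ 2 * (12 * B))) = 216 * (K₀ ^ 2 * q ^ 2) * (θ ^ 2 * (L ^ k * B)) := by ring
    rw [e]
    have hprod : K₀ ^ 2 * q ^ 2 ≤ 17424 * L ^ 4 * (49 / 100 * (L⁻¹) ^ 2) := mul_le_mul hK2 hq2 (sq_nonneg _) (by positivity)
    have e2 : 17424 * L ^ 4 * (49 / 100 * (L⁻¹) ^ 2) = 17424 * (49 / 100) * L ^ 2 * ((L⁻¹) ^ 2 * L ^ 2) := by ring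
    rw [e2, hLinv, mul_one] at hprod
    have h3 := mul_le_mul_of_nonneg_right hprod hLB0
    have hL2Y : 0 ≤ L ^ 2 * (θ ^ 2 * (L ^ k * B)) := by positivity
    linarith [h3, hL2Y]
  have hL4x : 0 ≤ L ^ 4 * (θ ^ 2 * x₀ ^ 2 * (L ^ k)⁻¹) := by positivity
  have hL2B : 0 ≤ L ^ 2 * (θ ^ 2 * (L ^ k * B)) := by positivity
  calc L ^ k * (θ * (3 / 2) * K₀ * ((3 / 2) * x₀ * ρ ^ (2 * k + 1) / (1 - ρ ^ 2))
        + θ * (3 / 2) * K₀ * q * (2 * (D * Real.sqrt B + θ * (3 / 2) * K₀ * ((3 / 2) * x₀ * ρ ^ (2 * k + 1) / (1 - ρ ^ 2))))) ^ 2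
      ≤ L ^ k * (8 * (θ * (3 / 2) * K₀ * ((3 / 2) * x₀ * ρ ^ (2 * k + 1) / (1 - ρ ^ 2))) ^ 2 + 8 * ((θ * (3 / 2) * K₀) ^ 2 * q ^ 2 * (D ^ 2 * B))) :=
        mul_le_mul_of_nonneg_left hsq hV.le
    _ = L ^ k * (8 * (θ * (3 / 2) * K₀ * ((3 / 2) * x₀ * ρ ^ (2 * k + 1) / (1 - ρ ^ 2))) ^ 2) + L ^ k * (8 * ((θ * (3 / 2) * K₀) ^ 2 * q ^ 2 * (D ^ 2 * B))) := by ring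
    _ ≤ 529254 * (L ^ 4 * (θ ^ 2 * x₀ ^ 2 * (L ^ k)⁻¹)) + 1845000 * (L ^ 2 * (θ ^ 2 * (L ^ k * B))) := add_le_add hPpart hBpart
    _ ≤ 2000000 * L ^ 2 * θ ^ 2 * (L ^ k * B) + 1000000 * L ^ 4 * θ ^ 2 * (L ^ k)⁻¹ * x₀ ^ 2 := by
        have e1 : 2000000 * L ^ 2 * θ ^ 2 * (L ^ k * B) = 2000000 * (L ^ 2 * (θ ^ 2 * (L ^ k * B))) := by ring
        have e2 : 1000000 * L ^ 4 * θ ^ 2 * (L ^ k)⁻¹ * x₀ ^ 2 = 1000000 * (L ^ 4 * (θ ^ 2 * x₀ ^ 2 * (L ^ k)⁻¹)) := by ring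
        rw [e1, e2]
        linarith [hL4x, hL2B]

end Summit.QuantumFields.YangMills.Theorems.Prop7TrueLinIterSharpLetters

end
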